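import Literature.NumberTheory.LFunctions.SuzukiWeilHilbertSpace
import Literature.Analysis.Fourier.L2FourierConj
import Literature.Analysis.Fourier.L2FourierReflection
import Literature.Analysis.Fourier.L2FourierDilation
import HarnessLib

/-!
# `𝒦(Θ) = 𝖥(V(0))` — CJM Lemma 5.1, first clause, RH-FREE (boundary-value form)

LINE 1 — LABEL: RH-FREE corpus theorems (M. Suzuki, *On the Hilbert space derived from the Weil
distribution*, Canad. J. Math. 2025 = arXiv:2301.00421v3, Lemma 5.1 with eq. (2.7); the proof is
[Su20a, Lemma 4.1]). bears_on: B-C/B-P (COLUMN 6 DBR). WHAT THIS IS NOT: a bridge between two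
RH-free subspaces of `L²(ℝ)` (the Fourier image of Suzuki's `V(0)` and the boundary-value model
space of `Θ_ξ`); it fixes vocabulary and does not move RH; no inner-function / Hermite–Biehler
property of `Θ_ξ`, `E_ξ` is asserted; nothing here bears on the truth of RH.

## What is proved

The module `SuzukiWeilHilbertSpace.lean` records the first clause "`𝒦(Θ) = 𝖥(V(0))`" of CJM
Lemma 5.1 as NOT TYPED ("no `H²(ℂ₊)` vocabulary in the tree"). The cell's screw-line module
(`SuzukiScrewLine.lean`, row t7) has since typed the Hardy space and the model space as sets of
`L²(ℝ)`-classes by boundary values: `hardyL2 = {F | 𝓕F ∈ L²(0,∞)}` (`H² = 𝖥L²(0,∞)`, CJM §2.3, in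
Mathlib's orientation `𝓕⁻`) and `modelSpaceL2 Θ = {F ∈ H² | F ⊥ Θ H²}` (`𝒦(Θ) = H² ⊖ ΘH²`,
CJM §2.4). Over these we PROVE, following the printed proof (TeX l.1474–1496) line by line:

* `inner_eq_zero_forall_hardyL2_iff` — `(H²)^⊥ = H̄² = 𝖩H²`: `F ⊥ H²` iff `conj ∘ F ∈ H²`
  (`L²(ℝ) = 𝖥L²(0,∞) ⊕ 𝖥L²(−∞,0)` and `(𝖥g)♯ = 𝖥g̃`, `g̃(x) = conj g(−x)`, TeX l.1492–1493; in
  the kernel: `𝓕 ∘ 𝖩 = 𝖩 ∘ 𝓕⁻` (`L2FourierConj`) and `𝓕⁻ = 𝓕 ∘ (reflection)` (`L2FourierReflection`));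
* `mem_modelSpaceL2_iff_of_norm_eq_one` — **eq. (2.7) `𝒦(Θ) = H² ∩ Θ H̄²` in boundary form**: for
  a measurable symbol with `|Θ| = 1` a.e. on `ℝ`, `F ∈ modelSpaceL2 Θ ⟺ F ∈ H² ∧ Θ·(conj ∘ F) ∈ H²`
  (RH-FREE: only unimodularity on the line is used, which for `Θ_ξ` is the tree's
  `norm_suzukiMultiplier_eq_one_ae`; under RH `Θ_ξ` is inner and this set IS the printed `𝒦(Θ_ξ)`);
* `fourierInv_mem_modelSpaceL2_iff`, `fourierInv_image_suzukiV_zero` — **`𝒦(Θ) = 𝖥(V(0))`** in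
  Mathlib's normalisation: `𝓕⁻ '' V(0) = modelSpaceL2 (Θ_ξ(2π·))`, where `𝓕⁻ψ(w) = ∫ψ(x)e^{2πixw}dx`
  is Suzuki's `(𝖥ψ)(2πw)` (the `Defs` module's convention bookkeeping: `(𝖥ψ)(u) = (𝓕ψ)(−u/2π)`)
  — printed steps: `𝖥ψ, 𝖥𝖪ψ ∈ H²` for `ψ ∈ V(0)`; `(𝖥𝖪ψ)(z) = Θ(z)(𝖥ψ)♯(z)` (definition (5.1));
  hence `𝖥ψ ∈ H² ∩ ΘH̄² = 𝒦(Θ)` by (2.7); conversely `F = 𝖥f = Θ·𝖥g` gives `𝖪f = g̃`-type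
  membership.

The dilation `u ↦ u/2π` that turns `modelSpaceL2 (Θ_ξ(2π·))` into the cell's
`modelSpaceL2 lagariasTheta` (the object of CJM Prop. 4.1, `Suzuki2025_prop41`) is bookkeeping of
the same kind and is left to a sequel (it needs the `L²` dilation theorem `𝓕(F(a·)) = |a|⁻¹(𝓕F)(·/a)`).

UPDATE (§D below): that sequel is carried out in this module — Suzuki's own `𝖥` on `L²(ℝ)`
(`suzukiFourierL2`, `(𝖥ψ)(u) = (𝓕⁻ψ)(u/2π)`, `‖𝖥ψ‖² = 2π‖ψ‖²`, `𝖥[ψ] = ψ̂` a.e. for `ψ ∈ L¹ ∩ L²`),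
the dilation invariance of `H²` (via the tree's `L2FourierDilation.fourier_toLp_comp_mul_left`), and
the verbatim form `suzukiFourierL2_image_suzukiV_zero : 𝖥 '' V(0) = modelSpaceL2 lagariasTheta`.

UPDATE (§E below): `⟪𝖥ψ, 𝖥φ⟫ = 2π⟪ψ, φ⟫` (`inner_suzukiFourierL2`), and BOUNDARY VALUES: for
`ψ ∈ L²(ℝ)`, `y > 0`, the honest half-plane values `x ↦ ψ̂(x + iy)` (`upperHalfHat`) form the class
`𝖥[1_{(0,∞)}ψ·e^{−y·}]` (`suzukiFourierL2_indicator_mul_exp_ae_eq`), which converges to `𝖥ψ` in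
`L²(ℝ)` as `y ↓ 0` for `ψ ∈ L²(0,∞)` (`norm_suzukiFourierL2_indicator_mul_exp_sub_lt`).

UPDATE (§F below): `ψ̂ = upperHalfHat ψ` is HOLOMORPHIC on `ℂ₊` for every `ψ ∈ L²(ℝ)`
(`hasDerivAt_upperHalfHat`, `differentiableOn_upperHalfHat`, `analyticOnNhd_upperHalfHat`), so
`z ↦ E_ξ(z)ψ̂(z)` is holomorphic on `ℂ₊` (`differentiableOn_lagariasE_mul_upperHalfHat`).

## References
* M. Suzuki, Canad. J. Math. 2025 (doi:10.4153/S0008414X25101739) = arXiv:2301.00421v3, Lemma 5.1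
  p. 13 (TeX l.1464–1496), eq. (2.7) p. 5 (TeX l.689–700), eq. (5.1)–(5.2). [Suzuki2025WeilHilbertSpace]
* M. Suzuki, *An inverse problem for a class of canonical systems having Hamiltonians of
  determinant one*, J. Funct. Anal. 279 (2020), Lemma 4.1 (the printed source of the proof). [cited via Suzuki2025WeilHilbertSpace]
-/

noncomputable section

open MeasureTheory Complex Filter Set
open scoped ComplexConjugate FourierTransform Topology ENNReal

namespace Literature.NumberTheory.LFunctions

open Literature.Analysis.Fourier

/-! ## A. `L²(0,∞)^⊥ = L²(−∞,0)` and `(H²)^⊥ = 𝖩H²` (RH-FREE plumbing) -/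

/-- The inner product of `L²(ℝ)` as an integral: `⟪f, g⟫ = ∫ conj f(x) g(x) dx`.
[cite: Suzuki2025WeilHilbertSpace, CJM §2.3 p. 5 (TeX l.615–619: "the inner product of H² coincides with the standard inner product of L²(ℝ)")] -/
theorem inner_L2_eq_integral (f g : Lp ℂ 2 (volume : Measure ℝ)) :
    inner ℂ f g = ∫ x : ℝ, conj ((f : ℝ → ℂ) x) * (g : ℝ → ℂ) x := by
  rw [L2.inner_def]
  exact integral_congr_ae (Eventually.of_forall fun x ↦
    (RCLike.inner_apply _ _).trans (mul_comm _ _))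

/-- `L²(0,∞)^⊥ = L²(−∞,0)` in `L²(ℝ)`: a class `g` is orthogonal to every class vanishing a.e. on
`(−∞,0)` iff `g` vanishes a.e. on `(0,∞)` ("`L²(ℝ) ⊖ L²(0,∞) = L²(−∞,0)`", the decomposition behind
`H̄² = H²(ℂ₋)` of (2.7)). RH-FREE. [cite: Suzuki2025WeilHilbertSpace, CJM §2.4 eq. (2.7) p. 5 (TeX l.689–700) and Lemma 5.1 proof (TeX l.1489–1491: "f ∈ L²(0,∞) and g ∈ L²(−∞,0)")] -/
theorem inner_eq_zero_forall_halfLineL2_iff (g : Lp ℂ 2 (volume : Measure ℝ)) :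
    (∀ f ∈ halfLineL2 0, inner ℂ f g = 0) ↔ ∀ᵐ x : ℝ, 0 < x → (g : ℝ → ℂ) x = 0 := by
  constructor
  · intro h
    -- test against `1_{(0,∞)} g ∈ L²(0,∞)`
    have hind : MemLp ((Ioi (0 : ℝ)).indicator (g : ℝ → ℂ)) 2 (volume : Measure ℝ) :=
      (Lp.memLp g).indicator measurableSet_Ioi
    have hmem : hind.toLp _ ∈ halfLineL2 0 := by
      simp only [halfLineL2, mem_setOf_eq]
      filter_upwards [hind.coeFn_toLp] with x hx hx0
      rw [hx, indicator_of_notMem (by simpa using hx0.le)]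
    have h0 := h _ hmem
    rw [inner_L2_eq_integral] at h0
    have hint : ∫ x : ℝ, conj ((hind.toLp _ : ℝ → ℂ) x) * (g : ℝ → ℂ) x =
        ((∫ x in Ioi (0 : ℝ), ‖(g : ℝ → ℂ) x‖ ^ 2 : ℝ) : ℂ) := by
      rw [← integral_indicator measurableSet_Ioi, ← integral_complex_ofReal]
      refine integral_congr_ae ?_
      filter_upwards [hind.coeFn_toLp] with x hx
      rw [hx]
      by_cases hx0 : x ∈ Ioi (0 : ℝ)
      · rw [indicator_of_mem hx0, indicator_of_mem hx0, Complex.conj_mul', Complex.ofReal_pow]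
      · rw [indicator_of_notMem hx0, indicator_of_notMem hx0, map_zero, zero_mul,
          Complex.ofReal_zero]
    rw [hint] at h0
    have h1 : ∫ x in Ioi (0 : ℝ), ‖(g : ℝ → ℂ) x‖ ^ 2 = 0 := by exact_mod_cast h0
    have hnn : 0 ≤ᵐ[volume.restrict (Ioi (0 : ℝ))] fun x ↦ ‖(g : ℝ → ℂ) x‖ ^ 2 :=
      Eventually.of_forall fun x ↦ by positivity
    have hi : Integrable (fun x ↦ ‖(g : ℝ → ℂ) x‖ ^ 2) (volume.restrict (Ioi (0 : ℝ))) :=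
      ((memLp_two_iff_integrable_sq_norm (Lp.aestronglyMeasurable g)).1 (Lp.memLp g)).restrict
    have h2 := (integral_eq_zero_iff_of_nonneg_ae hnn hi).1 h1
    rw [Filter.EventuallyEq, ae_restrict_iff' measurableSet_Ioi] at h2
    filter_upwards [h2] with x hx hx0
    have := hx hx0
    simp only [Pi.zero_apply, ne_eq, OfNat.ofNat_ne_zero, not_false_eq_true, pow_eq_zero_iff,
      norm_eq_zero] at this
    exact this
  · intro hg f hf
    rw [inner_L2_eq_integral]
    have h0 : ∀ᵐ x : ℝ, x ≠ 0 := by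
      have : ({0}ᶜ : Set ℝ) ∈ ae (volume : Measure ℝ) := by
        rw [compl_mem_ae_iff, measure_singleton]
      exact this
    simp only [halfLineL2, mem_setOf_eq] at hf
    refine integral_eq_zero_of_ae ?_
    filter_upwards [hf, hg, h0] with x h1 h2 h3
    rcases lt_or_gt_of_ne h3 with h | h
    · rw [h1 h, map_zero, zero_mul]; rfl
    · rw [h2 h, mul_zero]; rfl

/-- `F ∈ H²` iff its Fourier transform vanishes a.e. on `(−∞,0)` (the definition of the cell's
`hardyL2`, "`H² = 𝖥(L²(0,∞))` … identified with a closed subspace of `L²(ℝ)` via boundary values").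
[cite: Suzuki2025WeilHilbertSpace, CJM §2.3 p. 5 (TeX l.615–619)] -/
theorem mem_hardyL2_iff (F : Lp ℂ 2 (volume : Measure ℝ)) :
    F ∈ hardyL2 ↔ (𝓕 F : Lp ℂ 2 (volume : Measure ℝ)) ∈ halfLineL2 0 := Iff.rfl

/-- `𝖥ψ ∈ H² ⟺ ψ ∈ L²(0,∞)` (`H² = 𝖥(L²(0,∞))`; Mathlib orientation `𝓕⁻`, `𝓕𝓕⁻ = id`).
[cite: Suzuki2025WeilHilbertSpace, CJM §2.3 p. 5 (TeX l.615: "H² := H²(ℂ₊) = 𝖥(L²(0,∞))")] -/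
theorem fourierInv_mem_hardyL2_iff (ψ : Lp ℂ 2 (volume : Measure ℝ)) :
    (𝓕⁻ ψ : Lp ℂ 2 (volume : Measure ℝ)) ∈ hardyL2 ↔ ψ ∈ halfLineL2 0 := by
  rw [mem_hardyL2_iff, FourierTransform.fourier_fourierInv_eq]

/-- `H²` is exactly `𝖥(L²(0,∞))`: `hardyL2 = 𝓕⁻ '' L²(0,∞)`.
[cite: Suzuki2025WeilHilbertSpace, CJM §2.3 p. 5 (TeX l.615: "H² := H²(ℂ₊) = 𝖥(L²(0,∞))")] -/
theorem hardyL2_eq_image_fourierInv :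
    hardyL2 = (fun ψ : Lp ℂ 2 (volume : Measure ℝ) ↦ (𝓕⁻ ψ : Lp ℂ 2 (volume : Measure ℝ))) ''
      halfLineL2 0 := by
  ext F
  constructor
  · intro hF
    exact ⟨𝓕 F, hF, FourierTransform.fourierInv_fourier_eq F⟩
  · rintro ⟨ψ, hψ, rfl⟩
    exact (fourierInv_mem_hardyL2_iff ψ).2 hψ

/-- `𝖩F ∈ L²(t,∞)`-type statement: pointwise conjugation preserves vanishing a.e. on a set —
`𝖩f ∈ L²(0,∞) ⟺ f ∈ L²(0,∞)`. [cite: Suzuki2025WeilHilbertSpace, CJM Lemma 5.1 proof (TeX l.1492: "g̃(x) = conj g(−x) ∈ L²(0,∞)")] -/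
theorem suzukiJ_mem_halfLineL2_iff {t : ℝ} (f : Lp ℂ 2 (volume : Measure ℝ)) :
    suzukiJ f ∈ halfLineL2 t ↔ f ∈ halfLineL2 t := by
  simp only [halfLineL2, mem_setOf_eq]
  constructor
  · intro h
    filter_upwards [h, coeFn_suzukiJ f] with x h1 h2 hx
    have := h1 hx
    rw [h2] at this
    exact (map_eq_zero_iff _ (RingHom.injective _)).1 this
  · intro h
    filter_upwards [h, coeFn_suzukiJ f] with x h1 h2 hx
    rw [h2, h1 hx, map_zero]

/-- The reflection `R` exchanges `L²(0,∞)`-vanishing and `L²(−∞,0)`-vanishing: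
`Rg` vanishes a.e. on `(−∞,0)` iff `g` vanishes a.e. on `(0,∞)`.
[cite: Suzuki2025WeilHilbertSpace, CJM Lemma 5.1 proof (TeX l.1492: "g̃(x) = conj g(−x) ∈ L²(0,∞)" for g ∈ L²(−∞,0))] -/
theorem compNeg_mem_halfLineL2_zero_iff (g : Lp ℂ 2 (volume : Measure ℝ)) :
    Lp.compMeasurePreserving (fun x : ℝ => -x) (Measure.measurePreserving_neg (volume : Measure ℝ)) g
        ∈ halfLineL2 0 ↔ ∀ᵐ x : ℝ, 0 < x → (g : ℝ → ℂ) x = 0 := by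
  have hq : Measure.QuasiMeasurePreserving (fun x : ℝ => -x) volume volume :=
    (Measure.measurePreserving_neg (volume : Measure ℝ)).quasiMeasurePreserving
  simp only [halfLineL2, mem_setOf_eq]
  constructor
  · intro h
    have h' := hq.ae (h.and (coeFn_compNeg g))
    filter_upwards [h'] with x hx hx0
    simp only [neg_neg, Left.neg_neg_iff] at hx
    rw [← hx.2]
    exact hx.1 hx0
  · intro h
    filter_upwards [hq.ae h, coeFn_compNeg g] with x h1 h2 hx0
    rw [h2]
    exact h1 (by simpa using hx0)

/-- **`(H²)^⊥ = H̄² = 𝖩H²`**: a class `F ∈ L²(ℝ)` is orthogonal to the Hardy space iff its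
conjugate `conj ∘ F` belongs to the Hardy space (`L²(ℝ) = 𝖥L²(0,∞) ⊕ 𝖥L²(−∞,0)` by Plancherel,
and `(𝖥g)♯ = 𝖥g̃` on the line with `g̃(x) = conj g(−x)`). RH-FREE.
[cite: Suzuki2025WeilHilbertSpace, CJM §2.4 eq. (2.7) p. 5 ("H̄² = H²(ℂ₋)") and Lemma 5.1 proof (TeX l.1489–1493)] -/
theorem inner_eq_zero_forall_hardyL2_iff (F : Lp ℂ 2 (volume : Measure ℝ)) :
    (∀ G ∈ hardyL2, inner ℂ G F = 0) ↔ suzukiJ F ∈ hardyL2 := by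
  -- `G ∈ H²` iff `G = 𝓕⁻g`, `g ∈ L²(0,∞)`, and `⟪𝓕⁻g, F⟫ = ⟪g, 𝓕F⟫`
  have step1 : (∀ G ∈ hardyL2, inner ℂ G F = 0) ↔
      ∀ g ∈ halfLineL2 0, inner ℂ g (𝓕 F : Lp ℂ 2 (volume : Measure ℝ)) = 0 := by
    rw [hardyL2_eq_image_fourierInv, forall_mem_image]
    refine forall₂_congr fun g _ ↦ ?_
    rw [← Lp.inner_fourier_eq (𝓕⁻ g : Lp ℂ 2 (volume : Measure ℝ)) F,
      FourierTransform.fourier_fourierInv_eq]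
  rw [step1, inner_eq_zero_forall_halfLineL2_iff, mem_hardyL2_iff]
  -- `𝓕(𝖩F) = 𝖩(𝓕⁻F) = 𝖩(R(𝓕F))`
  have hJ : (𝓕 (suzukiJ F) : Lp ℂ 2 (volume : Measure ℝ)) =
      suzukiJ (Lp.compMeasurePreserving (fun x : ℝ => -x)
        (Measure.measurePreserving_neg (volume : Measure ℝ)) (𝓕 F : Lp ℂ 2 (volume : Measure ℝ))) := by
    rw [← fourierInv_eq_compNeg_fourier]
    exact fourier_conjLp F
  rw [hJ, suzukiJ_mem_halfLineL2_iff, compNeg_mem_halfLineL2_zero_iff]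


/-! ## B. Eq. (2.7) `𝒦(Θ) = H² ∩ Θ H̄²` in boundary form (RH-FREE: `|Θ| = 1` a.e. on `ℝ` only) -/

/-- For a symbol with `|Θ| = 1` a.e. on the line and `F ∈ L²(ℝ)`, the class of `conj Θ · F`
(resp. `Θ · conj F`) is again in `L²(ℝ)` (`𝖬_Θ`, `𝖩` are isometries of `L²(ℝ)`).
[cite: Suzuki2025WeilHilbertSpace, CJM §5 p. 13 (TeX l.1436–1440: "𝖬_Θ and the involution 𝖩 are … isometries on L²(ℝ)")] -/
theorem memLp_symbol_mul_conj {Θ : ℂ → ℂ} (hΘm : Measurable Θ) (hΘ1 : ∀ᵐ x : ℝ, ‖Θ x‖ = 1)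
    (F : Lp ℂ 2 (volume : Measure ℝ)) :
    MemLp (fun x : ℝ ↦ Θ x * conj ((F : ℝ → ℂ) x)) 2 volume := by
  refine MemLp.of_le (Lp.memLp F) ?_ ?_
  · exact ((hΘm.comp Complex.measurable_ofReal).aestronglyMeasurable).mul
      (Complex.continuous_conj.comp_aestronglyMeasurable (Lp.aestronglyMeasurable F))
  · filter_upwards [hΘ1] with x hx
    rw [norm_mul, hx, one_mul, Complex.norm_conj]

/-- **CJM eq. (2.7) `𝒦(Θ) = H² ∩ Θ H̄²`, boundary-value form, RH-FREE.** For a measurable symbol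
`Θ` with `|Θ(x)| = 1` for a.e. real `x`, a class `F ∈ L²(ℝ)` lies in the cell's model space
`modelSpaceL2 Θ = {F ∈ H² | F ⊥ ΘH²}` iff `F ∈ H²` and `Θ · (conj ∘ F) ∈ H²` — i.e.
`F ∈ H² ∩ Θ·𝖩H² = H² ∩ Θ H̄²` (`(H²)^⊥ = 𝖩H²`, `inner_eq_zero_forall_hardyL2_iff`). Printed for an
inner function `Θ`; only `|Θ| = 1` a.e. on `ℝ` is used, which for `Θ = Θ_ξ` holds unconditionally
(`norm_suzukiMultiplier_eq_one_ae`; under RH `Θ_ξ` is inner, [La06, Thm. 1], and `modelSpaceL2 Θ_ξ`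
is the printed model space). The element `Θ·(conj ∘ F)` is phrased as "some `G ∈ H²` with
`G = Θ · conj F` a.e." (the class exists by `memLp_symbol_mul_conj`).
[cite: Suzuki2025WeilHilbertSpace, CJM §2.4 eq. (2.7) p. 5 (TeX l.689–700: "𝒦(Θ) = H² ⊖ ΘH² … has the alternative representation 𝒦(Θ) = H² ∩ Θ H̄²")] -/
theorem mem_modelSpaceL2_iff_of_norm_eq_one {Θ : ℂ → ℂ} (hΘm : Measurable Θ)
    (hΘ1 : ∀ᵐ x : ℝ, ‖Θ x‖ = 1) (F : Lp ℂ 2 (volume : Measure ℝ)) :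
    F ∈ modelSpaceL2 Θ ↔ F ∈ hardyL2 ∧
      ∃ G ∈ hardyL2, (G : ℝ → ℂ) =ᵐ[volume] fun x : ℝ ↦ Θ x * conj ((F : ℝ → ℂ) x) := by
  -- `K := conj Θ · F ∈ L²(ℝ)` and `∫ conj(Θ G) F = ⟪G, K⟫`
  have hΘc : Measurable fun z : ℂ ↦ conj (Θ z) := Complex.continuous_conj.measurable.comp hΘm
  have hΘc1 : ∀ᵐ x : ℝ, ‖conj (Θ x)‖ = 1 := by
    filter_upwards [hΘ1] with x hx; rw [Complex.norm_conj, hx]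
  have hKm : MemLp (fun x : ℝ ↦ conj (Θ x) * (F : ℝ → ℂ) x) 2 volume := by
    refine MemLp.of_le (Lp.memLp F) ?_ ?_
    · exact ((hΘc.comp Complex.measurable_ofReal).aestronglyMeasurable).mul
        (Lp.aestronglyMeasurable F)
    · filter_upwards [hΘc1] with x hx
      rw [norm_mul, hx, one_mul]
  set K : Lp ℂ 2 (volume : Measure ℝ) := hKm.toLp _ with hK_def
  have hK : (K : ℝ → ℂ) =ᵐ[volume] fun x : ℝ ↦ conj (Θ x) * (F : ℝ → ℂ) x := hKm.coeFn_toLp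
  have hint : ∀ G : Lp ℂ 2 (volume : Measure ℝ),
      ∫ x : ℝ, conj (Θ x * (G : ℝ → ℂ) x) * (F : ℝ → ℂ) x = inner ℂ G K := by
    intro G
    rw [inner_L2_eq_integral]
    refine integral_congr_ae ?_
    filter_upwards [hK] with x hx
    rw [hx, map_mul]; ring
  have hJK : (suzukiJ K : ℝ → ℂ) =ᵐ[volume] fun x : ℝ ↦ Θ x * conj ((F : ℝ → ℂ) x) := by
    filter_upwards [coeFn_suzukiJ K, hK] with x h1 h2
    rw [h1, h2, map_mul, Complex.conj_conj]
  change (F ∈ hardyL2 ∧ ∀ G ∈ hardyL2, ∫ x : ℝ, conj (Θ x * (G : ℝ → ℂ) x) * (F : ℝ → ℂ) x = 0) ↔ _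
  simp_rw [hint]
  rw [inner_eq_zero_forall_hardyL2_iff K]
  refine and_congr_right fun _ ↦ ⟨fun h ↦ ⟨suzukiJ K, h, hJK⟩, fun ⟨G, hG, hGae⟩ ↦ ?_⟩
  have : G = suzukiJ K := Lp.ext (hGae.trans hJK.symm)
  rwa [this] at hG

/-! ## C. `𝒦(Θ) = 𝖥(V(0))` (CJM Lemma 5.1, first clause; RH-FREE) -/

/-- `|Θ_ξ(2πx)| = 1` for almost every real `x` (the tree's `norm_suzukiMultiplier_eq_one_ae`,
`Θ̃(ξ) = Θ_ξ(−2πξ)`, reflected). RH-FREE.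
[cite: Suzuki2025WeilHilbertSpace, CJM §5 p. 13 (TeX l.1436–1441: "𝖬_Θ … isometries on L²(ℝ)")] -/
theorem norm_lagariasTheta_two_pi_mul_ae :
    ∀ᵐ x : ℝ, ‖lagariasTheta (2 * Real.pi * (x : ℂ))‖ = 1 := by
  have hq : Measure.QuasiMeasurePreserving (fun x : ℝ => -x) volume volume :=
    (Measure.measurePreserving_neg (volume : Measure ℝ)).quasiMeasurePreserving
  filter_upwards [hq.ae norm_suzukiMultiplier_eq_one_ae] with x hx
  have e : ((-2 * Real.pi * -x : ℝ) : ℂ) = 2 * Real.pi * (x : ℂ) := by push_cast; ring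
  simpa only [suzukiMultiplier, e] using hx

/-- The symbol `z ↦ Θ_ξ(2πz)` is measurable (plumbing). [cite: Suzuki2025WeilHilbertSpace, CJM eq. (1.4) p. 2 (Θ_ξ := E_ξ♯/E_ξ)] -/
theorem measurable_lagariasTheta_two_pi_mul :
    Measurable fun z : ℂ ↦ lagariasTheta (2 * Real.pi * z) :=
  measurable_lagariasTheta.comp (measurable_const.mul measurable_id)

/-- **"`(𝖥𝖪ψ)(z) = Θ(z)(𝖥ψ)♯(z)` by definition (5.1)"** on the boundary, in Mathlib's normalisation:
for every `ψ ∈ L²(ℝ)`, `𝓕⁻(𝖪ψ)(x) = Θ_ξ(2πx) · conj (𝓕⁻ψ)(x)` for a.e. real `x`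
(`𝖪 = 𝓕⁻ 𝖬_{Θ̃} 𝖩 𝓕`, `𝓕⁻𝓕⁻ =` reflection, `𝓕⁻ = ` reflection `∘ 𝓕`). RH-FREE.
[cite: Suzuki2025WeilHilbertSpace, CJM Lemma 5.1 proof p. 13 (TeX l.1480–1482) and eq. (5.1)] -/
theorem fourierInv_suzukiK_ae_eq (ψ : Lp ℂ 2 (volume : Measure ℝ)) :
    ((𝓕⁻ (suzukiK ψ) : Lp ℂ 2 (volume : Measure ℝ)) : ℝ → ℂ) =ᵐ[volume]
      fun x : ℝ ↦ lagariasTheta (2 * Real.pi * (x : ℂ)) *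
        conj (((𝓕⁻ ψ : Lp ℂ 2 (volume : Measure ℝ)) : ℝ → ℂ) x) := by
  have hq : Measure.QuasiMeasurePreserving (fun x : ℝ => -x) volume volume :=
    (Measure.measurePreserving_neg (volume : Measure ℝ)).quasiMeasurePreserving
  have h1 : (𝓕⁻ (suzukiK ψ) : Lp ℂ 2 (volume : Measure ℝ)) =
      Lp.compMeasurePreserving (fun x : ℝ => -x) (Measure.measurePreserving_neg (volume : Measure ℝ))
        (suzukiM (suzukiJ (𝓕 ψ : Lp ℂ 2 (volume : Measure ℝ)))) := by
    unfold suzukiK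
    exact fourierInv_fourierInv_eq_compNeg _
  have h2 : (𝓕⁻ ψ : Lp ℂ 2 (volume : Measure ℝ)) =
      Lp.compMeasurePreserving (fun x : ℝ => -x) (Measure.measurePreserving_neg (volume : Measure ℝ))
        (𝓕 ψ : Lp ℂ 2 (volume : Measure ℝ)) := fourierInv_eq_compNeg_fourier ψ
  rw [h1, h2]
  filter_upwards [coeFn_compNeg (suzukiM (suzukiJ (𝓕 ψ : Lp ℂ 2 (volume : Measure ℝ)))),
    coeFn_compNeg (𝓕 ψ : Lp ℂ 2 (volume : Measure ℝ)),
    hq.ae (coeFn_suzukiM (suzukiJ (𝓕 ψ : Lp ℂ 2 (volume : Measure ℝ)))),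
    hq.ae (coeFn_suzukiJ (𝓕 ψ : Lp ℂ 2 (volume : Measure ℝ)))] with x e1 e2 e3 e4
  rw [e1, e2, e3, e4]
  have e : ((-2 * Real.pi * -x : ℝ) : ℂ) = 2 * Real.pi * (x : ℂ) := by push_cast; ring
  simp only [suzukiMultiplier, e]

/-- **CJM Lemma 5.1, first clause `𝒦(Θ) = 𝖥(V(0))` — membership form, RH-FREE.** For
`ψ ∈ L²(ℝ)`: `𝖥ψ ∈ 𝒦(Θ)` iff `ψ ∈ V(0) = L²(0,∞) ∩ 𝖪L²(0,∞)`, in Mathlib's normalisation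
(`𝖥 ↦ 𝓕⁻`, `𝒦(Θ) ↦ modelSpaceL2 (Θ_ξ(2π·))`, boundary-value model space of the screw-line module;
`(𝖥ψ)(u) = (𝓕⁻ψ)(u/2π)`). Printed proof, followed: "`𝖥ψ` and `𝖥𝖪ψ` belong to `H² = 𝖥(L²(0,∞))`
… `(𝖥𝖪ψ)(z) = Θ(z)(𝖥ψ)♯(z)` … therefore `𝖥ψ ∈ 𝒦(Θ)` by (2.7)"; conversely
"`F = 𝖥f = Θ·𝖥g` … `Θ(𝖥f)♯ = 𝖥𝖪f` … hence `𝖪f ∈ L²(0,∞)`, thus `f ∈ V(0)`". Under RH the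
right-hand object is the printed `𝒦(Θ_ξ)`; no property of `Θ_ξ` beyond `|Θ_ξ| = 1` a.e. on `ℝ` is
used. [cite: Suzuki2025WeilHilbertSpace, CJM Lemma 5.1 p. 13 (TeX l.1464–1496) (= [Su20a, Lemma 4.1]); eq. (2.7), (5.1), (5.2)] -/
theorem fourierInv_mem_modelSpaceL2_iff (ψ : Lp ℂ 2 (volume : Measure ℝ)) :
    (𝓕⁻ ψ : Lp ℂ 2 (volume : Measure ℝ)) ∈
        modelSpaceL2 (fun z : ℂ ↦ lagariasTheta (2 * Real.pi * z)) ↔ ψ ∈ suzukiV 0 := by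
  rw [mem_modelSpaceL2_iff_of_norm_eq_one measurable_lagariasTheta_two_pi_mul
      norm_lagariasTheta_two_pi_mul_ae, mem_suzukiV_iff, fourierInv_mem_hardyL2_iff]
  refine and_congr_right fun _ ↦ ⟨fun ⟨G, hG, hGae⟩ ↦ ?_, fun hK ↦ ?_⟩
  · have : G = (𝓕⁻ (suzukiK ψ) : Lp ℂ 2 (volume : Measure ℝ)) :=
      Lp.ext (hGae.trans (fourierInv_suzukiK_ae_eq ψ).symm)
    rw [this, fourierInv_mem_hardyL2_iff] at hG
    exact hG
  · exact ⟨𝓕⁻ (suzukiK ψ), (fourierInv_mem_hardyL2_iff _).2 hK, fourierInv_suzukiK_ae_eq ψ⟩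

/-- **CJM Lemma 5.1, first clause: `𝒦(Θ) = 𝖥(V(0))`** as an equality of subsets of `L²(ℝ)`,
RH-FREE, in Mathlib's normalisation of the Fourier transform: the image of Suzuki's space `V(0)`
(the `Defs` module's `suzukiV 0`) under `𝓕⁻` (Suzuki's `𝖥` up to the dilation `u ↦ u/2π`) is the
boundary-value model space of the symbol `Θ_ξ(2π·)`. bears_on B-C/B-P: this is the bridge by which
CJM transports the orthonormal basis `F_γ` of `𝒦(Θ)` (Prop. 4.1, row t7) to the basis `ψ_γ` of
`V(0)` ((5.11), `Suzuki2025_orthogonalBasis`); typing it as a theorem replaces the prose link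
between the cell's two vocabularies. WHAT THIS IS NOT: no statement about RH.
[cite: Suzuki2025WeilHilbertSpace, CJM Lemma 5.1 p. 13 (TeX l.1464–1471: "𝒦(Θ) = 𝖥(V(0)), and hence 𝓗(E) = E𝖥(V(0))"), proof TeX l.1474–1496] -/
theorem fourierInv_image_suzukiV_zero :
    (fun ψ : Lp ℂ 2 (volume : Measure ℝ) ↦ (𝓕⁻ ψ : Lp ℂ 2 (volume : Measure ℝ))) '' suzukiV 0 =
      modelSpaceL2 (fun z : ℂ ↦ lagariasTheta (2 * Real.pi * z)) := by
  ext F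
  constructor
  · rintro ⟨ψ, hψ, rfl⟩
    exact (fourierInv_mem_modelSpaceL2_iff ψ).2 hψ
  · intro hF
    refine ⟨𝓕 F, (fourierInv_mem_modelSpaceL2_iff _).1 ?_, FourierTransform.fourierInv_fourier_eq F⟩
    rw [FourierTransform.fourierInv_fourier_eq]
    exact hF

/-- Consequently `V(0) = 𝓕(𝒦(Θ_ξ(2π·)))`: Suzuki's RH-free space is the Fourier PRE-image of an
RH-free boundary-value model space; in particular "`V(0) ≠ {0}`" (Suzuki's open question, CJM
Remark 5.2) is the statement that this model space is non-zero. RH-FREE.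
[cite: Suzuki2025WeilHilbertSpace, CJM Lemma 5.1 p. 13 and Remark 5.2 p. 14 (TeX l.1500–1510)] -/
theorem suzukiV_zero_eq_image_fourier :
    suzukiV 0 = (fun F : Lp ℂ 2 (volume : Measure ℝ) ↦ (𝓕 F : Lp ℂ 2 (volume : Measure ℝ))) ''
      modelSpaceL2 (fun z : ℂ ↦ lagariasTheta (2 * Real.pi * z)) := by
  rw [← fourierInv_image_suzukiV_zero, Set.image_image]
  simp only [FourierTransform.fourier_fourierInv_eq, Set.image_id']

/-- `V(0) = {0}` iff the boundary-value model space of `Θ_ξ(2π·)` is `{0}` (transport of Suzuki's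
open question "prove or disprove `V(0) ≠ {0}` unconditionally" — CJM Remark 5.2 — to the model
space; neither side is asserted). RH-FREE.
[cite: Suzuki2025WeilHilbertSpace, CJM Remark 5.2 p. 14 (TeX l.1500–1510) with Lemma 5.1] -/
theorem suzukiV_zero_eq_singleton_iff :
    suzukiV 0 = {0} ↔ modelSpaceL2 (fun z : ℂ ↦ lagariasTheta (2 * Real.pi * z)) = {0} := by
  rw [← fourierInv_image_suzukiV_zero]
  constructor
  · intro h
    rw [h, Set.image_singleton, FourierTransform.fourierInv_zero]
  · intro h
    have hinj : Function.Injective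
        (fun ψ : Lp ℂ 2 (volume : Measure ℝ) ↦ (𝓕⁻ ψ : Lp ℂ 2 (volume : Measure ℝ))) :=
      (Lp.fourierTransformₗᵢ ℝ ℂ).symm.injective
    have h0 : (fun ψ : Lp ℂ 2 (volume : Measure ℝ) ↦ (𝓕⁻ ψ : Lp ℂ 2 (volume : Measure ℝ))) ''
        {0} = {0} := by
      rw [Set.image_singleton, FourierTransform.fourierInv_zero]
    rw [← h0] at h
    exact (Set.image_eq_image hinj).1 h



/-! ## D. Suzuki's own normalisation: `𝖥` on `L²(ℝ)` and `𝒦(Θ_ξ) = 𝖥(V(0))` verbatim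

`(𝖥ψ)(u) = ∫ ψ(x)e^{iux}dx = (𝓕⁻ψ)(u/2π)` (the `Defs` module's convention bookkeeping), so Suzuki's
`𝖥` on `L²(ℝ)` is Mathlib's `𝓕⁻` followed by the dilation `u ↦ u/2π`; dilating the symbol back,
`𝒦(Θ_ξ(2π·))` becomes the screw-line module's `modelSpaceL2 lagariasTheta` — the object of CJM
Prop. 4.1 (`Suzuki2025_prop41`: under RH, `(F_γ)` is an orthonormal basis of it). -/

/-- **Suzuki's Fourier transform `𝖥` on `L²(ℝ)`**: `(𝖥ψ)(u) = ∫ ψ(x)e^{iux}dx`, realised on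
classes as `u ↦ (𝓕⁻ψ)(u/2π)` (Mathlib's inverse `L²` transform `𝓕⁻ψ(w) = ∫ψ(x)e^{2πixw}dx` dilated
by `(2π)⁻¹`; agrees a.e. with the integral `suzukiHat ψ` for `ψ ∈ L¹ ∩ L²`,
`suzukiFourierL2_toLp_ae_eq_suzukiHat`). "An isometry up to a constant factor": `‖𝖥ψ‖² = 2π‖ψ‖²`
(`norm_sq_suzukiFourierL2`). RH-FREE object.
[cite: Suzuki2025WeilHilbertSpace, CJM eq. (1.1) p. 2 ("ψ̂(z) = (𝖥ψ)(z) := ∫ ψ(x)e^{izx}dx") and §5 p. 13 (TeX l.1441: "𝖥 is an isometry up to a constant factor")] -/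
def suzukiFourierL2 (ψ : Lp ℂ 2 (volume : Measure ℝ)) : Lp ℂ 2 (volume : Measure ℝ) :=
  (memLp_comp_mul_left (Lp.memLp (𝓕⁻ ψ : Lp ℂ 2 (volume : Measure ℝ)))
    (inv_ne_zero Real.two_pi_pos.ne')).toLp _

/-- `(𝖥ψ)(u) = (𝓕⁻ψ)(u/2π)` almost everywhere. [cite: Suzuki2025WeilHilbertSpace, CJM eq. (1.1) p. 2] -/
theorem coeFn_suzukiFourierL2 (ψ : Lp ℂ 2 (volume : Measure ℝ)) :
    (suzukiFourierL2 ψ : ℝ → ℂ) =ᵐ[volume]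
      fun u : ℝ ↦ ((𝓕⁻ ψ : Lp ℂ 2 (volume : Measure ℝ)) : ℝ → ℂ) ((2 * Real.pi)⁻¹ * u) :=
  coeFn_toLp_comp_mul_left _ (inv_ne_zero Real.two_pi_pos.ne')

/-- **`‖𝖥ψ‖² = 2π‖ψ‖²`** (CJM (5.8) "`2π‖ψ‖²_{L²(ℝ)} = ‖ψ̂‖²_{L²(ℝ)}`", for every class
`ψ ∈ L²(ℝ)`; Plancherel `‖𝓕⁻ψ‖ = ‖ψ‖` and the dilation `‖F(·/2π)‖² = 2π‖F‖²`). RH-FREE.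
[cite: Suzuki2025WeilHilbertSpace, CJM eq. (5.8) p. 15 (TeX l.1697) and §5 p. 13 (TeX l.1441)] -/
theorem norm_sq_suzukiFourierL2 (ψ : Lp ℂ 2 (volume : Measure ℝ)) :
    ‖suzukiFourierL2 ψ‖ ^ 2 = 2 * Real.pi * ‖ψ‖ ^ 2 := by
  have h1 : ((2 * Real.pi) ^ (1 / 2 : ℝ)) ^ 2 = 2 * Real.pi := by
    rw [← Real.rpow_natCast, ← Real.rpow_mul Real.two_pi_pos.le]
    norm_num
  have h2 : ‖(𝓕⁻ ψ : Lp ℂ 2 (volume : Measure ℝ))‖ = ‖ψ‖ := by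
    rw [← Lp.norm_fourier_eq (𝓕⁻ ψ : Lp ℂ 2 (volume : Measure ℝ)),
      FourierTransform.fourier_fourierInv_eq]
  rw [suzukiFourierL2, norm_toLp_comp_mul_left _ (inv_ne_zero Real.two_pi_pos.ne'), abs_inv, inv_inv,
    abs_of_pos Real.two_pi_pos, mul_pow, h1, h2]

/-- `𝖥` is additive. [cite: Suzuki2025WeilHilbertSpace, CJM §5 p. 13 (TeX l.1436–1444: 𝖥, 𝖬_Θ, 𝖩 as operators on L²(ℝ))] -/
theorem suzukiFourierL2_add (ψ φ : Lp ℂ 2 (volume : Measure ℝ)) :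
    suzukiFourierL2 (ψ + φ) = suzukiFourierL2 ψ + suzukiFourierL2 φ := by
  unfold suzukiFourierL2
  rw [← toLp_comp_mul_left_add _ _ (inv_ne_zero Real.two_pi_pos.ne')]
  exact MemLp.toLp_congr _ _ (Filter.EventuallyEq.of_eq (by rw [FourierTransform.fourierInv_add]))

/-- `𝖥` is `ℂ`-homogeneous. [cite: Suzuki2025WeilHilbertSpace, CJM §5 p. 13 (TeX l.1436–1444)] -/
theorem suzukiFourierL2_smul (a : ℂ) (ψ : Lp ℂ 2 (volume : Measure ℝ)) :
    suzukiFourierL2 (a • ψ) = a • suzukiFourierL2 ψ := by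
  have hc : (2 * Real.pi)⁻¹ ≠ 0 := inv_ne_zero Real.two_pi_pos.ne'
  apply Lp.ext
  filter_upwards [coeFn_suzukiFourierL2 (a • ψ), coeFn_suzukiFourierL2 ψ,
    Lp.coeFn_smul a (suzukiFourierL2 ψ),
    ((measurePreserving_mul_left hc).quasiMeasurePreserving.mono_right
      Measure.smul_absolutelyContinuous).ae
      (Lp.coeFn_smul a (𝓕⁻ ψ : Lp ℂ 2 (volume : Measure ℝ)))] with u h1 h2 h3 h4
  rw [h1, h3, Pi.smul_apply, h2, FourierTransform.fourierInv_smul]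
  exact h4

/-- **Dictionary with the integral transform**: for `ψ ∈ L¹(ℝ) ∩ L²(ℝ)`, the class `𝖥[ψ]` is
represented by Suzuki's `ψ̂(u) = ∫ψ(x)e^{iux}dx` (`suzukiHat`), i.e. `𝖥[ψ] = ψ̂` a.e. — so
`suzukiFourierL2` IS the transform (1.1) on `L¹ ∩ L²`, extended to `L²(ℝ)` by Plancherel. RH-FREE.
[cite: Suzuki2025WeilHilbertSpace, CJM eq. (1.1) p. 2 and §2.3 p. 5 (TeX l.615–619)] -/
theorem suzukiFourierL2_toLp_ae_eq_suzukiHat {ψ : ℝ → ℂ} (h1 : Integrable ψ) (h2 : MemLp ψ 2 volume) :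
    (suzukiFourierL2 (h2.toLp ψ) : ℝ → ℂ) =ᵐ[volume] fun u : ℝ ↦ suzukiHat ψ u := by
  have hc : (2 * Real.pi)⁻¹ ≠ 0 := inv_ne_zero Real.two_pi_pos.ne'
  have hq := (measurePreserving_mul_left hc).quasiMeasurePreserving.mono_right
    Measure.smul_absolutelyContinuous
  have hqn : Measure.QuasiMeasurePreserving (fun x : ℝ => -x) volume volume :=
    (Measure.measurePreserving_neg (volume : Measure ℝ)).quasiMeasurePreserving
  -- `𝓕⁻[ψ] = R 𝓕[ψ] = (𝓕ψ)(−·)` a.e.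
  have hinv : ((𝓕⁻ (h2.toLp ψ) : Lp ℂ 2 (volume : Measure ℝ)) : ℝ → ℂ) =ᵐ[volume]
      fun w : ℝ ↦ 𝓕 ψ (-w) := by
    rw [fourierInv_eq_compNeg_fourier]
    filter_upwards [coeFn_compNeg (𝓕 (h2.toLp ψ) : Lp ℂ 2 (volume : Measure ℝ)),
      hqn.ae (Literature.Analysis.FunctionSpaces.fourier_toLp_ae_eq_fourierIntegral h1 h2)]
      with w e1 e2
    rw [e1, e2]
  filter_upwards [coeFn_suzukiFourierL2 (h2.toLp ψ), hq.ae hinv] with u e1 e2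
  rw [e1, e2, suzukiHat_ofReal_eq_fourier, show -((2 * Real.pi)⁻¹ * u) = -u / (2 * Real.pi) by ring]

/-- A positive dilation preserves vanishing a.e. on `(−∞,0)`: `F(c·) ∈ L²(0,∞)`-side iff `F` is
(`c > 0`; plumbing for the dilation invariance of `H²`).
[cite: Suzuki2025WeilHilbertSpace, CJM §2.3 p. 5 (TeX l.615: "H² = 𝖥(L²(0,∞))")] -/
theorem toLp_comp_mul_left_mem_halfLineL2_zero_iff (G : Lp ℂ 2 (volume : Measure ℝ)) {c : ℝ}
    (hc : 0 < c) :
    ((memLp_comp_mul_left (Lp.memLp G) hc.ne').toLp _ : Lp ℂ 2 (volume : Measure ℝ)) ∈ halfLineL2 0 ↔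
      G ∈ halfLineL2 0 := by
  have hq := (measurePreserving_mul_left hc.ne').quasiMeasurePreserving.mono_right
    Measure.smul_absolutelyContinuous
  have hq' := (measurePreserving_mul_left (inv_ne_zero hc.ne')).quasiMeasurePreserving.mono_right
    Measure.smul_absolutelyContinuous
  simp only [halfLineL2, mem_setOf_eq]
  constructor
  · intro h
    filter_upwards [hq'.ae (h.and (coeFn_toLp_comp_mul_left G hc.ne'))] with y hy hy0
    rcases hy with ⟨hy1, hy2⟩
    simp only [mul_inv_cancel_left₀ hc.ne'] at hy1 hy2
    rw [← hy2]
    exact hy1 (mul_neg_of_pos_of_neg (inv_pos.2 hc) hy0)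
  · intro h
    filter_upwards [hq.ae h, coeFn_toLp_comp_mul_left G hc.ne'] with x h1 h2 hx0
    rw [h2]
    exact h1 (mul_neg_of_pos_of_neg hc hx0)

/-- **`H²` is dilation invariant**: for `c > 0`, `F(c·) ∈ H²` iff `F ∈ H²`
(`𝓕(F(c·)) = c⁻¹(𝓕F)(·/c)` and `(0,∞)` is dilation invariant). RH-FREE.
[cite: Suzuki2025WeilHilbertSpace, CJM §2.3 p. 5 (TeX l.615–619)] -/
theorem toLp_comp_mul_left_mem_hardyL2_iff (F : Lp ℂ 2 (volume : Measure ℝ)) {c : ℝ} (hc : 0 < c) :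
    ((memLp_comp_mul_left (Lp.memLp F) hc.ne').toLp _ : Lp ℂ 2 (volume : Measure ℝ)) ∈ hardyL2 ↔
      F ∈ hardyL2 := by
  rw [mem_hardyL2_iff, mem_hardyL2_iff, fourier_toLp_comp_mul_left F hc.ne',
    ← toLp_comp_mul_left_mem_halfLineL2_zero_iff (𝓕 F : Lp ℂ 2 (volume : Measure ℝ))
      (inv_pos.2 hc)]
  -- scaling by the nonzero real `|c|⁻¹` does not change membership in `L²(0,∞)`
  set G : Lp ℂ 2 (volume : Measure ℝ) := (memLp_comp_mul_left (Lp.memLp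
    (𝓕 F : Lp ℂ 2 (volume : Measure ℝ))) (inv_pos.2 hc).ne').toLp _ with hG
  simp only [halfLineL2, mem_setOf_eq]
  have hk : (|c|⁻¹ : ℝ) ≠ 0 := inv_ne_zero (abs_pos.2 hc.ne').ne'
  constructor
  · intro h
    filter_upwards [h, Lp.coeFn_smul |c|⁻¹ G] with x h1 h2 hx
    have := h1 hx
    rw [h2, Pi.smul_apply, smul_eq_zero] at this
    exact this.resolve_left hk
  · intro h
    filter_upwards [h, Lp.coeFn_smul |c|⁻¹ G] with x h1 h2 hx
    rw [h2, Pi.smul_apply, h1 hx, smul_zero]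

/-- `|Θ_ξ(x)| = 1` for almost every real `x` (off the null set of real zeros of `E_ξ`; the cell's
`ae_lagariasE_ofReal_ne_zero` in another module — here from `norm_lagariasTheta_two_pi_mul_ae` by
dilation). RH-FREE. [cite: Suzuki2025WeilHilbertSpace, CJM §3.2 p. 8 ("|Θ(z)| = 1 for every z ∈ ℝ")] -/
theorem norm_lagariasTheta_ofReal_ae : ∀ᵐ x : ℝ, ‖lagariasTheta (x : ℂ)‖ = 1 := by
  have hc : (2 * Real.pi)⁻¹ ≠ 0 := inv_ne_zero Real.two_pi_pos.ne'
  have hq := (measurePreserving_mul_left hc).quasiMeasurePreserving.mono_right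
    Measure.smul_absolutelyContinuous
  filter_upwards [hq.ae norm_lagariasTheta_two_pi_mul_ae] with x hx
  have e : (2 * Real.pi : ℂ) * (((2 * Real.pi)⁻¹ * x : ℝ) : ℂ) = (x : ℂ) := by
    have hπ : (Real.pi : ℂ) ≠ 0 := Complex.ofReal_ne_zero.2 Real.pi_ne_zero
    push_cast
    field_simp
  simpa only [e] using hx

/-- **CJM Lemma 5.1, first clause, in Suzuki's own normalisation — membership form, RH-FREE:**
`𝖥ψ ∈ 𝒦(Θ_ξ)` iff `ψ ∈ V(0)`, where `𝒦(Θ_ξ)` is the screw-line module's boundary-value model space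
`modelSpaceL2 lagariasTheta` (the object of CJM Prop. 4.1) and `𝖥` is `suzukiFourierL2`.
[cite: Suzuki2025WeilHilbertSpace, CJM Lemma 5.1 p. 13 (TeX l.1464–1496)] -/
theorem suzukiFourierL2_mem_modelSpaceL2_iff (ψ : Lp ℂ 2 (volume : Measure ℝ)) :
    suzukiFourierL2 ψ ∈ modelSpaceL2 lagariasTheta ↔ ψ ∈ suzukiV 0 := by
  have hc : (0 : ℝ) < (2 * Real.pi)⁻¹ := inv_pos.2 Real.two_pi_pos
  have hq := (measurePreserving_mul_left hc.ne').quasiMeasurePreserving.mono_right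
    Measure.smul_absolutelyContinuous
  have hq' := (measurePreserving_mul_left (inv_ne_zero hc.ne')).quasiMeasurePreserving.mono_right
    Measure.smul_absolutelyContinuous
  rw [← fourierInv_mem_modelSpaceL2_iff,
    mem_modelSpaceL2_iff_of_norm_eq_one measurable_lagariasTheta norm_lagariasTheta_ofReal_ae,
    mem_modelSpaceL2_iff_of_norm_eq_one measurable_lagariasTheta_two_pi_mul
      norm_lagariasTheta_two_pi_mul_ae]
  set F : Lp ℂ 2 (volume : Measure ℝ) := 𝓕⁻ ψ with hF
  have hSF : suzukiFourierL2 ψ = (memLp_comp_mul_left (Lp.memLp F) hc.ne').toLp _ := rfl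
  rw [hSF, toLp_comp_mul_left_mem_hardyL2_iff F hc]
  refine and_congr_right fun _ ↦ ⟨fun ⟨G, hG, hGae⟩ ↦ ?_, fun ⟨G, hG, hGae⟩ ↦ ?_⟩
  · -- `G' := G(·/2π)·` i.e. the dilate of `G` by `2π = c⁻¹`
    refine ⟨(memLp_comp_mul_left (Lp.memLp G) (inv_ne_zero hc.ne')).toLp _,
      (toLp_comp_mul_left_mem_hardyL2_iff G (inv_pos.2 hc)).2 hG, ?_⟩
    filter_upwards [coeFn_toLp_comp_mul_left G (inv_ne_zero hc.ne'),
      hq'.ae (hGae.and (coeFn_toLp_comp_mul_left F hc.ne'))] with w e1 e2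
    rcases e2 with ⟨e2, e3⟩
    simp only [mul_inv_cancel_left₀ hc.ne'] at e2 e3
    rw [e1, e2, e3, inv_inv]
    push_cast
    ring_nf
  · refine ⟨(memLp_comp_mul_left (Lp.memLp G) hc.ne').toLp _,
      (toLp_comp_mul_left_mem_hardyL2_iff G hc).2 hG, ?_⟩
    filter_upwards [coeFn_toLp_comp_mul_left G hc.ne', hq.ae hGae,
      coeFn_toLp_comp_mul_left F hc.ne'] with u e1 e2 e3
    rw [e1, e2, e3]
    congr 2
    push_cast
    field_simp

/-- `δ^{c}(δ^{1/c}F) = F`: the dilations by `c` and `c⁻¹` are inverse to each other on `L²(ℝ)`.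
[cite: Suzuki2025WeilHilbertSpace, CJM §5 p. 13 (TeX l.1441–1444: 𝖥 invertible on L²(ℝ) up to a constant)] -/
theorem toLp_comp_mul_left_toLp_comp_mul_left_inv (F : Lp ℂ 2 (volume : Measure ℝ)) {c : ℝ}
    (hc : c ≠ 0) :
    ((memLp_comp_mul_left (Lp.memLp ((memLp_comp_mul_left (Lp.memLp F) (inv_ne_zero hc)).toLp _ :
        Lp ℂ 2 (volume : Measure ℝ))) hc).toLp _ : Lp ℂ 2 (volume : Measure ℝ)) = F := by
  have hq := (measurePreserving_mul_left hc).quasiMeasurePreserving.mono_right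
    Measure.smul_absolutelyContinuous
  apply Lp.ext
  filter_upwards [coeFn_toLp_comp_mul_left ((memLp_comp_mul_left (Lp.memLp F)
      (inv_ne_zero hc)).toLp _ : Lp ℂ 2 (volume : Measure ℝ)) hc,
    hq.ae (coeFn_toLp_comp_mul_left F (inv_ne_zero hc))] with x e1 e2
  rw [e1, e2, inv_mul_cancel_left₀ hc]

/-- `𝖥` is onto `L²(ℝ)`: every class is `𝖥ψ` with `ψ = 𝓕(F(2π·))`.
[cite: Suzuki2025WeilHilbertSpace, CJM §5 p. 13 (TeX l.1441–1444)] -/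
theorem suzukiFourierL2_surjective : Function.Surjective suzukiFourierL2 := by
  intro F
  have hc : (2 * Real.pi)⁻¹ ≠ 0 := inv_ne_zero Real.two_pi_pos.ne'
  set X : Lp ℂ 2 (volume : Measure ℝ) :=
    (memLp_comp_mul_left (Lp.memLp F) (inv_ne_zero hc)).toLp _ with hX
  refine ⟨𝓕 X, ?_⟩
  have e : (𝓕⁻ (𝓕 X : Lp ℂ 2 (volume : Measure ℝ)) : Lp ℂ 2 (volume : Measure ℝ)) = X :=
    FourierTransform.fourierInv_fourier_eq X
  unfold suzukiFourierL2
  calc _ = ((memLp_comp_mul_left (Lp.memLp X) hc).toLp _ : Lp ℂ 2 (volume : Measure ℝ)) :=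
        MemLp.toLp_congr _ _ (Filter.EventuallyEq.of_eq (by rw [e]))
    _ = F := toLp_comp_mul_left_toLp_comp_mul_left_inv F hc

/-- **CJM Lemma 5.1, first clause: `𝒦(Θ_ξ) = 𝖥(V(0))` verbatim** — the screw-line module's
boundary-value model space `modelSpaceL2 lagariasTheta` is the image of the `Defs` module's `V(0)`
under Suzuki's `L²` Fourier transform `𝖥`. RH-FREE (only `|Θ_ξ| = 1` a.e. on `ℝ` is used; under RH
`Θ_ξ` is inner and the left side is the printed model space `𝒦(Θ_ξ) = H² ⊖ Θ_ξH²`). bears_on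
B-C/B-P (COLUMN 6 DBR): the kernel link between `Suzuki2025_prop41` (ONB `F_γ` of `𝒦(Θ)`, row t7)
and `Suzuki2025_orthogonalBasis` (basis `ψ_γ = 𝖥⁻¹F_γ` of `V(0)`, (5.11)). WHAT THIS IS NOT: no
statement about RH. [cite: Suzuki2025WeilHilbertSpace, CJM Lemma 5.1 p. 13 (TeX l.1464–1471: "𝒦(Θ) = 𝖥(V(0))"), proof TeX l.1474–1496 (= [Su20a, Lemma 4.1])] -/
theorem suzukiFourierL2_image_suzukiV_zero :
    suzukiFourierL2 '' suzukiV 0 = modelSpaceL2 lagariasTheta := by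
  ext F
  constructor
  · rintro ⟨ψ, hψ, rfl⟩
    exact (suzukiFourierL2_mem_modelSpaceL2_iff ψ).2 hψ
  · intro hF
    obtain ⟨ψ, rfl⟩ := suzukiFourierL2_surjective F
    exact ⟨ψ, (suzukiFourierL2_mem_modelSpaceL2_iff ψ).1 hF, rfl⟩


/-- **`⟪𝖥ψ, 𝖥φ⟫ = 2π⟪ψ, φ⟫`** — Suzuki's `𝖥` is unitary up to the factor `2π` (Plancherel for
`𝓕⁻` and the dilation `u ↦ u/2π`): the Hilbert space structure that `V(0)` induces on `𝒦(Θ_ξ)`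
("the inner product of `𝒦(Θ)` matches that of `L²(ℝ)`", CJM §2.4; "the Hilbert space structure is
the one induced from `V(t)`", Thm. 5.7). RH-FREE.
[cite: Suzuki2025WeilHilbertSpace, CJM §5 p. 13 (TeX l.1441: "𝖥 is an isometry up to a constant factor") and §2.4 p. 5 (TeX l.697–700)] -/
theorem inner_suzukiFourierL2 (ψ φ : Lp ℂ 2 (volume : Measure ℝ)) :
    inner ℂ (suzukiFourierL2 ψ) (suzukiFourierL2 φ) = ((2 * Real.pi : ℝ) : ℂ) * inner ℂ ψ φ := by
  have hc : (2 * Real.pi)⁻¹ ≠ 0 := inv_ne_zero Real.two_pi_pos.ne'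
  have hP : inner ℂ ψ φ = inner ℂ (𝓕⁻ ψ : Lp ℂ 2 (volume : Measure ℝ))
      (𝓕⁻ φ : Lp ℂ 2 (volume : Measure ℝ)) := by
    rw [← Lp.inner_fourier_eq (𝓕⁻ ψ : Lp ℂ 2 (volume : Measure ℝ))
      (𝓕⁻ φ : Lp ℂ 2 (volume : Measure ℝ)), FourierTransform.fourier_fourierInv_eq,
      FourierTransform.fourier_fourierInv_eq]
  rw [inner_L2_eq_integral, hP, inner_L2_eq_integral]
  have hae : (fun u : ℝ ↦ conj ((suzukiFourierL2 ψ : ℝ → ℂ) u) * (suzukiFourierL2 φ : ℝ → ℂ) u)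
      =ᵐ[volume] fun u : ℝ ↦ (fun w : ℝ ↦ conj (((𝓕⁻ ψ : Lp ℂ 2 (volume : Measure ℝ)) : ℝ → ℂ) w) *
        ((𝓕⁻ φ : Lp ℂ 2 (volume : Measure ℝ)) : ℝ → ℂ) w) ((2 * Real.pi)⁻¹ * u) := by
    filter_upwards [coeFn_suzukiFourierL2 ψ, coeFn_suzukiFourierL2 φ] with u h1 h2
    rw [h1, h2]
  rw [integral_congr_ae hae, Measure.integral_comp_mul_left
      (fun w : ℝ ↦ conj (((𝓕⁻ ψ : Lp ℂ 2 (volume : Measure ℝ)) : ℝ → ℂ) w) *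
        ((𝓕⁻ φ : Lp ℂ 2 (volume : Measure ℝ)) : ℝ → ℂ) w) ((2 * Real.pi)⁻¹),
    inv_inv, abs_of_pos Real.two_pi_pos, Complex.real_smul]

/-! ## E. Boundary values: `ψ̂(· + iy) → 𝖥ψ` in `L²(ℝ)` (RH-FREE)

CJM §2.3 (TeX l.615–619): "`H² = 𝖥(L²(0,∞))` … we identify `H²` with a closed subspace of `L²(ℝ)`
via boundary values." The `Defs` module evaluates `ψ̂(z) = ∫₀^∞ ψ(x)e^{izx}dx` for `Im z > 0`
HONESTLY (`upperHalfHat`); here we prove that these values ARE the boundary-value class `𝖥ψ` in the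
`L²` sense: for `ψ ∈ L²(ℝ)` and `y > 0`, `x ↦ ψ̂(x + iy)` is the class `𝖥[1_{(0,∞)}ψ · e^{−y·}]`, and
these classes converge to `𝖥[1_{(0,∞)}ψ]` (`= 𝖥ψ` for `ψ ∈ L²(0,∞)`) in `L²(ℝ)` as `y ↓ 0`. -/

/-- `|1_{(0,∞)}(t) ψ(t) e^{−yt}| ≤ |ψ(t)|` for `y ≥ 0` (the damped half-line function is dominated by
`ψ`). [cite: Suzuki2025WeilHilbertSpace, CJM §2.3 p. 5 (TeX l.615–619)] -/
theorem norm_indicator_mul_exp_le (f : Lp ℂ 2 (volume : Measure ℝ)) {y : ℝ} (hy : 0 ≤ y) (t : ℝ) :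
    ‖(Ioi (0 : ℝ)).indicator (f : ℝ → ℂ) t * (Real.exp (-(y * t)) : ℂ)‖ ≤ ‖(f : ℝ → ℂ) t‖ := by
  by_cases ht : t ∈ Ioi (0 : ℝ)
  · rw [indicator_of_mem ht, norm_mul, Complex.norm_real, Real.norm_eq_abs,
      abs_of_pos (Real.exp_pos _)]
    have h1 : Real.exp (-(y * t)) ≤ 1 :=
      Real.exp_le_one_iff.2 (by nlinarith [mem_Ioi.1 ht])
    calc ‖(f : ℝ → ℂ) t‖ * Real.exp (-(y * t)) ≤ ‖(f : ℝ → ℂ) t‖ * 1 := by gcongr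
      _ = ‖(f : ℝ → ℂ) t‖ := mul_one _
  · rw [indicator_of_notMem ht, zero_mul, norm_zero]
    exact norm_nonneg _

/-- The damped half-line function `1_{(0,∞)}ψ · e^{−y·}` is a.e.-strongly measurable (plumbing).
[cite: Suzuki2025WeilHilbertSpace, CJM §2.3 p. 5 (TeX l.615–619)] -/
theorem aestronglyMeasurable_indicator_mul_exp (f : Lp ℂ 2 (volume : Measure ℝ)) (y : ℝ) :
    AEStronglyMeasurable
      (fun t : ℝ ↦ (Ioi (0 : ℝ)).indicator (f : ℝ → ℂ) t * (Real.exp (-(y * t)) : ℂ)) volume :=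
  ((Lp.aestronglyMeasurable f).indicator measurableSet_Ioi).mul
    (Complex.continuous_ofReal.comp (Real.continuous_exp.comp
      ((continuous_const.mul continuous_id).neg))).aestronglyMeasurable

/-- `1_{(0,∞)}ψ · e^{−y·} ∈ L²(ℝ)` for `ψ ∈ L²(ℝ)`, `y ≥ 0`.
[cite: Suzuki2025WeilHilbertSpace, CJM §2.3 p. 5 (TeX l.615–619)] -/
theorem memLp_two_indicator_mul_exp (f : Lp ℂ 2 (volume : Measure ℝ)) {y : ℝ} (hy : 0 ≤ y) :
    MemLp (fun t : ℝ ↦ (Ioi (0 : ℝ)).indicator (f : ℝ → ℂ) t * (Real.exp (-(y * t)) : ℂ)) 2 volume :=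
  MemLp.of_le (Lp.memLp f) (aestronglyMeasurable_indicator_mul_exp f y)
    (Eventually.of_forall (norm_indicator_mul_exp_le f hy))

/-- `1_{(0,∞)}ψ · e^{−y·} ∈ L¹(ℝ)` for `ψ ∈ L²(ℝ)`, `y > 0` (Cauchy–Schwarz against `e^{−yt}`; the
`Defs` module's `integrable_mul_cexp_Ioi` at `z = iy`).
[cite: Suzuki2025WeilHilbertSpace, CJM §2.2–2.3 p. 4–5 ("H²(ℂ₊) = 𝖥(L²(0,∞))")] -/
theorem integrable_indicator_mul_exp (f : Lp ℂ 2 (volume : Measure ℝ)) {y : ℝ} (hy : 0 < y) :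
    Integrable (fun t : ℝ ↦ (Ioi (0 : ℝ)).indicator (f : ℝ → ℂ) t * (Real.exp (-(y * t)) : ℂ))
      volume := by
  have hz : 0 < (I * (y : ℂ)).im := by simpa using hy
  have h := integrable_mul_cexp_Ioi f hz
  have heq : (fun t : ℝ ↦ (Ioi (0 : ℝ)).indicator (f : ℝ → ℂ) t * (Real.exp (-(y * t)) : ℂ)) =
      (Ioi (0 : ℝ)).indicator (fun t : ℝ ↦ (f : ℝ → ℂ) t * cexp (I * (I * (y : ℂ)) * t)) := by
    funext t
    by_cases ht : t ∈ Ioi (0 : ℝ)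
    · rw [indicator_of_mem ht, indicator_of_mem ht, Complex.ofReal_exp]
      congr 2
      push_cast
      linear_combination (-(y : ℂ) * (t : ℂ)) * Complex.I_mul_I
    · rw [indicator_of_notMem ht, indicator_of_notMem ht, zero_mul]
  rw [heq, integrable_indicator_iff measurableSet_Ioi]
  exact h

/-- **`ψ̂(x + iy)` is the Fourier integral of the damped function**: for every `ψ ∈ L²(ℝ)`, real `x`
and real `y`, `ψ̂(x + iy) = ∫₀^∞ ψ(t)e^{i(x+iy)t}dt = (1_{(0,∞)}ψ · e^{−y·})^(x)` (the `Defs` module's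
`upperHalfHat` versus the whole-line `suzukiHat`; exact, junk values included).
[cite: Suzuki2025WeilHilbertSpace, CJM eq. (1.1) p. 2 and §2.3 p. 5 (TeX l.615–619)] -/
theorem upperHalfHat_eq_suzukiHat_indicator_mul_exp (f : Lp ℂ 2 (volume : Measure ℝ)) (x y : ℝ) :
    upperHalfHat f ((x : ℂ) + I * y) =
      suzukiHat (fun t : ℝ ↦ (Ioi (0 : ℝ)).indicator (f : ℝ → ℂ) t * (Real.exp (-(y * t)) : ℂ)) x := by
  unfold upperHalfHat suzukiHat
  rw [← integral_indicator measurableSet_Ioi]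
  refine integral_congr_ae (Eventually.of_forall fun t ↦ ?_)
  simp only
  by_cases ht : t ∈ Ioi (0 : ℝ)
  · rw [indicator_of_mem ht, indicator_of_mem ht, Complex.ofReal_exp]
    conv_rhs => rw [mul_assoc, ← Complex.exp_add]
    congr 2
    push_cast
    linear_combination ((y : ℂ) * (t : ℂ)) * Complex.I_mul_I
  · rw [indicator_of_notMem ht, indicator_of_notMem ht, zero_mul, zero_mul]

/-- **The class of `x ↦ ψ̂(x + iy)` is `𝖥[1_{(0,∞)}ψ · e^{−y·}]`** (`y > 0`): Suzuki's transform of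
the damped half-line function, as an `L²(ℝ)`-class, is represented by the honest values
`ψ̂(x+iy) = ∫₀^∞ψ(t)e^{i(x+iy)t}dt`. RH-FREE.
[cite: Suzuki2025WeilHilbertSpace, CJM §2.3 p. 5 (TeX l.615–619: "we identify H² with a closed subspace of L²(ℝ) via boundary values")] -/
theorem suzukiFourierL2_indicator_mul_exp_ae_eq (f : Lp ℂ 2 (volume : Measure ℝ)) {y : ℝ} (hy : 0 < y) :
    (suzukiFourierL2 ((memLp_two_indicator_mul_exp f hy.le).toLp _) : ℝ → ℂ) =ᵐ[volume]
      fun x : ℝ ↦ upperHalfHat f ((x : ℂ) + I * y) := by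
  filter_upwards [suzukiFourierL2_toLp_ae_eq_suzukiHat (integrable_indicator_mul_exp f hy)
    (memLp_two_indicator_mul_exp f hy.le)] with x hx
  rw [hx, upperHalfHat_eq_suzukiHat_indicator_mul_exp]

/-- **The damped functions converge in `L²`**: `‖1_{(0,∞)}ψ·e^{−y·} − 1_{(0,∞)}ψ‖_{L²} → 0` as
`y ↓ 0` (dominated convergence: `|e^{−yt} − 1| ≤ 1` on `t > 0`), in `ε`–`δ` form (the `L²` class of
the damped function needs `y ≥ 0`). RH-FREE.
[cite: Suzuki2025WeilHilbertSpace, CJM §2.3 p. 5 (TeX l.615–619: "identify H² with a closed subspace of L²(ℝ) via boundary values")] -/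
theorem norm_toLp_indicator_mul_exp_sub_lt (f : Lp ℂ 2 (volume : Measure ℝ)) {ε : ℝ} (hε : 0 < ε) :
    ∃ δ > 0, ∀ y : ℝ, ∀ hy : 0 < y, y < δ →
      ‖((memLp_two_indicator_mul_exp f hy.le).toLp _ : Lp ℂ 2 (volume : Measure ℝ)) -
          ((Lp.memLp f).indicator measurableSet_Ioi).toLp ((Ioi (0 : ℝ)).indicator (f : ℝ → ℂ))‖ < ε := by
  -- the real integrals `∫ ‖g_y − g_0‖²` tend to `0` by dominated convergence
  set F : ℝ → ℝ → ℝ := fun y t ↦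
    ‖(Ioi (0 : ℝ)).indicator (f : ℝ → ℂ) t * (Real.exp (-(y * t)) : ℂ) -
      (Ioi (0 : ℝ)).indicator (f : ℝ → ℂ) t‖ ^ 2 with hF
  have hg0 : ∀ t : ℝ, (Ioi (0 : ℝ)).indicator (f : ℝ → ℂ) t =
      (Ioi (0 : ℝ)).indicator (f : ℝ → ℂ) t * (Real.exp (-(0 * t)) : ℂ) := by
    intro t; simp
  have hFmeas : ∀ y : ℝ, AEStronglyMeasurable (F y) volume := fun y ↦
    ((aestronglyMeasurable_indicator_mul_exp f y).sub
      ((Lp.aestronglyMeasurable f).indicator measurableSet_Ioi)).norm.pow 2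
  have hFbound : ∀ y : ℝ, 0 < y → ∀ t : ℝ, ‖F y t‖ ≤ ‖(f : ℝ → ℂ) t‖ ^ 2 := by
    intro y hy t
    rw [hF]
    simp only [norm_pow, norm_norm]
    gcongr
    by_cases ht : t ∈ Ioi (0 : ℝ)
    · rw [indicator_of_mem ht, ← mul_sub_one, norm_mul]
      have h1 : ‖(Real.exp (-(y * t)) : ℂ) - 1‖ ≤ 1 := by
        have e0 : 0 < Real.exp (-(y * t)) := Real.exp_pos _
        have e1 : Real.exp (-(y * t)) ≤ 1 :=
          Real.exp_le_one_iff.2 (by nlinarith [mem_Ioi.1 ht])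
        rw [show ((Real.exp (-(y * t)) : ℂ) - 1) = ((Real.exp (-(y * t)) - 1 : ℝ) : ℂ) by push_cast; ring,
          Complex.norm_real, Real.norm_eq_abs, abs_le]
        constructor <;> linarith
      calc ‖(f : ℝ → ℂ) t‖ * ‖(Real.exp (-(y * t)) : ℂ) - 1‖ ≤ ‖(f : ℝ → ℂ) t‖ * 1 := by gcongr
        _ = ‖(f : ℝ → ℂ) t‖ := mul_one _
    · rw [indicator_of_notMem ht, zero_mul, sub_zero, norm_zero]
      exact norm_nonneg _
  have hFint : Integrable (fun t : ℝ ↦ ‖(f : ℝ → ℂ) t‖ ^ 2) volume :=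
    (memLp_two_iff_integrable_sq_norm (Lp.aestronglyMeasurable f)).1 (Lp.memLp f)
  have hFlim : ∀ t : ℝ, Tendsto (fun y : ℝ ↦ F y t) (𝓝[>] 0) (𝓝 0) := by
    intro t
    have hc : Continuous fun y : ℝ ↦
        (Ioi (0 : ℝ)).indicator (f : ℝ → ℂ) t * (Real.exp (-(y * t)) : ℂ) -
          (Ioi (0 : ℝ)).indicator (f : ℝ → ℂ) t := by fun_prop
    have h0 := ((hc.tendsto 0).norm).pow 2
    rw [← hg0 t, sub_self, norm_zero, zero_pow two_ne_zero] at h0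
    exact h0.mono_left nhdsWithin_le_nhds
  have hT : Tendsto (fun y : ℝ ↦ ∫ t, F y t) (𝓝[>] 0) (𝓝 0) := by
    have h := tendsto_integral_filter_of_dominated_convergence (fun t : ℝ ↦ ‖(f : ℝ → ℂ) t‖ ^ 2)
      (Eventually.of_forall hFmeas)
      (eventually_nhdsWithin_of_forall fun y hy ↦ Eventually.of_forall (hFbound y hy)) hFint
      (Eventually.of_forall hFlim)
    rwa [integral_zero] at h
  -- extract `δ`
  have hev : ∀ᶠ y in 𝓝[>] (0 : ℝ), ∫ t, F y t < ε ^ 2 := hT (gt_mem_nhds (by positivity))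
  rw [eventually_nhdsWithin_iff, Metric.eventually_nhds_iff] at hev
  obtain ⟨δ, hδ, hδε⟩ := hev
  refine ⟨δ, hδ, fun y hy hyδ ↦ ?_⟩
  have hlt : ∫ t, F y t < ε ^ 2 := hδε (by simpa [abs_of_pos hy] using hyδ) hy
  -- the norm is `(∫ F y)^{1/2}`
  have hm : MemLp ((Ioi (0 : ℝ)).indicator (f : ℝ → ℂ)) 2 (volume : Measure ℝ) :=
    (Lp.memLp f).indicator measurableSet_Ioi
  have hsub := (memLp_two_indicator_mul_exp f hy.le).sub hm
  rw [← MemLp.toLp_sub (memLp_two_indicator_mul_exp f hy.le) hm,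
    Lp.norm_toLp, MemLp.eLpNorm_eq_integral_rpow_norm two_ne_zero ENNReal.ofNat_ne_top hsub,
    ENNReal.toReal_ofReal (Real.rpow_nonneg (integral_nonneg fun t ↦ by positivity) _)]
  simp only [ENNReal.toReal_ofNat, Real.rpow_two, Pi.sub_apply]
  have hnn : 0 ≤ ∫ t, F y t := integral_nonneg fun t ↦ by positivity
  calc (∫ t, F y t) ^ (2 : ℝ)⁻¹ < (ε ^ 2) ^ (2 : ℝ)⁻¹ :=
        Real.rpow_lt_rpow hnn hlt (by norm_num)
    _ = ε := by
        rw [show (2 : ℝ)⁻¹ = ((2 : ℕ) : ℝ)⁻¹ by norm_num]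
        exact Real.pow_rpow_inv_natCast hε.le two_ne_zero

/-- For `ψ ∈ L²(0,∞)` the class of `1_{(0,∞)}ψ` is `ψ` itself. [cite: Suzuki2025WeilHilbertSpace, CJM §2.3 p. 5 (TeX l.615: "H² = 𝖥(L²(0,∞))")] -/
theorem toLp_indicator_eq_of_mem_halfLineL2 {f : Lp ℂ 2 (volume : Measure ℝ)} (hf : f ∈ halfLineL2 0) :
    (((Lp.memLp f).indicator measurableSet_Ioi).toLp ((Ioi (0 : ℝ)).indicator (f : ℝ → ℂ)) :
      Lp ℂ 2 (volume : Measure ℝ)) = f := by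
  apply Lp.ext
  have h0 : ∀ᵐ x : ℝ, x ≠ 0 := by
    have : ({0}ᶜ : Set ℝ) ∈ ae (volume : Measure ℝ) := by
      rw [compl_mem_ae_iff, measure_singleton]
    exact this
  have hm : MemLp ((Ioi (0 : ℝ)).indicator (f : ℝ → ℂ)) 2 (volume : Measure ℝ) :=
    (Lp.memLp f).indicator measurableSet_Ioi
  have hf' : ∀ᵐ x : ℝ, x < 0 → (f : ℝ → ℂ) x = 0 := hf
  filter_upwards [hm.coeFn_toLp, hf', h0] with x h1 h2 h3
  rw [h1]
  by_cases hx : x ∈ Ioi (0 : ℝ)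
  · rw [indicator_of_mem hx]
  · rw [indicator_of_notMem hx, h2 (lt_of_le_of_ne (not_lt.1 hx) h3)]

/-- `𝖥` is continuous on `L²(ℝ)` (additive with `‖𝖥ψ‖ = √(2π)‖ψ‖`).
[cite: Suzuki2025WeilHilbertSpace, CJM §5 p. 13 (TeX l.1441: "𝖥 is an isometry up to a constant factor")] -/
theorem continuous_suzukiFourierL2 : Continuous suzukiFourierL2 := by
  let T : Lp ℂ 2 (volume : Measure ℝ) →+ Lp ℂ 2 (volume : Measure ℝ) :=
    { toFun := suzukiFourierL2
      map_zero' := by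
        have h := suzukiFourierL2_add 0 0
        rw [add_zero] at h
        exact left_eq_add.mp h
      map_add' := suzukiFourierL2_add }
  refine AddMonoidHomClass.continuous_of_bound T ((2 * Real.pi) ^ (1 / 2 : ℝ)) fun ψ ↦ le_of_eq ?_
  have h := norm_sq_suzukiFourierL2 ψ
  have h1 : (0 : ℝ) ≤ ‖suzukiFourierL2 ψ‖ := norm_nonneg _
  have h2 : ((2 * Real.pi) ^ (1 / 2 : ℝ)) ^ 2 = 2 * Real.pi := by
    rw [← Real.rpow_natCast, ← Real.rpow_mul Real.two_pi_pos.le]; norm_num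
  have h3 : ‖suzukiFourierL2 ψ‖ ^ 2 = ((2 * Real.pi) ^ (1 / 2 : ℝ) * ‖ψ‖) ^ 2 := by
    rw [h, mul_pow, h2]
  have h4 : (0 : ℝ) ≤ (2 * Real.pi) ^ (1 / 2 : ℝ) * ‖ψ‖ := by positivity
  exact (pow_left_inj₀ h1 h4 two_ne_zero).1 h3

/-- `𝖥(ψ − φ) = 𝖥ψ − 𝖥φ`. [cite: Suzuki2025WeilHilbertSpace, CJM §5 p. 13 (TeX l.1436–1444)] -/
theorem suzukiFourierL2_sub (ψ φ : Lp ℂ 2 (volume : Measure ℝ)) :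
    suzukiFourierL2 (ψ - φ) = suzukiFourierL2 ψ - suzukiFourierL2 φ := by
  have h := suzukiFourierL2_add (ψ - φ) φ
  rw [sub_add_cancel] at h
  rw [h, add_sub_cancel_right]

/-- **Boundary values in `L²`: `ψ̂(· + iy) → 𝖥ψ` as `y ↓ 0`** for `ψ ∈ L²(0,∞)`. Precisely: for every
`ε > 0` there is `δ > 0` such that for `0 < y < δ` the class of `x ↦ ψ̂(x + iy) = ∫₀^∞ψ(t)e^{i(x+iy)t}dt`
(`= 𝖥[ψ·e^{−y·}]`, `suzukiFourierL2_indicator_mul_exp_ae_eq`) is within `ε` of `𝖥ψ` in `L²(ℝ)`.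
This is the sense in which "`H² = 𝖥(L²(0,∞))` is identified with a closed subspace of `L²(ℝ)` via
boundary values" for the honest half-plane transform `upperHalfHat` of the `Defs` module. RH-FREE.
[cite: Suzuki2025WeilHilbertSpace, CJM §2.3 p. 5 (TeX l.615–619)] -/
theorem norm_suzukiFourierL2_indicator_mul_exp_sub_lt {f : Lp ℂ 2 (volume : Measure ℝ)}
    (hf : f ∈ halfLineL2 0) {ε : ℝ} (hε : 0 < ε) :
    ∃ δ > 0, ∀ y : ℝ, ∀ hy : 0 < y, y < δ →
      ‖suzukiFourierL2 ((memLp_two_indicator_mul_exp f hy.le).toLp _) - suzukiFourierL2 f‖ < ε := by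
  have hε' : 0 < ε / (2 * Real.pi) ^ (1 / 2 : ℝ) := by positivity
  obtain ⟨δ, hδ, h⟩ := norm_toLp_indicator_mul_exp_sub_lt f hε'
  refine ⟨δ, hδ, fun y hy hyδ ↦ ?_⟩
  have h1 := h y hy hyδ
  rw [toLp_indicator_eq_of_mem_halfLineL2 hf] at h1
  rw [← suzukiFourierL2_sub]
  have h2 : (0 : ℝ) < (2 * Real.pi) ^ (1 / 2 : ℝ) := by positivity
  have h3 : ((2 * Real.pi) ^ (1 / 2 : ℝ)) ^ 2 = 2 * Real.pi := by
    rw [← Real.rpow_natCast, ← Real.rpow_mul Real.two_pi_pos.le]; norm_num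
  have h4 : ‖suzukiFourierL2 (((memLp_two_indicator_mul_exp f hy.le).toLp _ :
      Lp ℂ 2 (volume : Measure ℝ)) - f)‖ =
      (2 * Real.pi) ^ (1 / 2 : ℝ) * ‖((memLp_two_indicator_mul_exp f hy.le).toLp _ :
        Lp ℂ 2 (volume : Measure ℝ)) - f‖ := by
    have h5 := norm_sq_suzukiFourierL2 (((memLp_two_indicator_mul_exp f hy.le).toLp _ :
      Lp ℂ 2 (volume : Measure ℝ)) - f)
    rw [← h3, ← mul_pow] at h5
    exact (pow_left_inj₀ (norm_nonneg _) (by positivity) two_ne_zero).1 h5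
  rw [h4]
  calc (2 * Real.pi) ^ (1 / 2 : ℝ) * ‖((memLp_two_indicator_mul_exp f hy.le).toLp _ :
        Lp ℂ 2 (volume : Measure ℝ)) - f‖
      < (2 * Real.pi) ^ (1 / 2 : ℝ) * (ε / (2 * Real.pi) ^ (1 / 2 : ℝ)) := by gcongr
    _ = ε := mul_div_cancel₀ ε h2.ne'


/-! ## F. `ψ̂` is holomorphic on `ℂ₊` (RH-FREE)

CJM §2.2–2.3: the Hardy space `H²(ℂ₊) = 𝖥(L²(0,∞))` consists of functions ANALYTIC in the upper
half-plane. For the `Defs` module's honest transform `ψ̂(z) = ∫₀^∞ ψ(t)e^{izt}dt` (`upperHalfHat`,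
any `ψ ∈ L²(ℝ)`) we prove holomorphy on `Im z > 0` by differentiation under the integral sign, with
derivative `∫₀^∞ ψ(t)·it·e^{izt}dt` (dominated, near `z₀`, by `(4/Im z₀)|ψ(t)|e^{−(Im z₀)t/4}`). -/

/-- `x·e^{−x} ≤ 1` (from `x + 1 ≤ eˣ`); plumbing for the dominating function. [folklore] -/
private theorem mul_exp_neg_le_one (x : ℝ) : x * Real.exp (-x) ≤ 1 := by
  rw [Real.exp_neg, ← div_eq_mul_inv, div_le_one (Real.exp_pos x)]
  linarith [Real.add_one_le_exp x]

/-- **`ψ̂` is complex-differentiable on `ℂ₊`** with `ψ̂′(z) = ∫₀^∞ ψ(t)(it)e^{izt}dt`, for every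
`ψ ∈ L²(ℝ)` and `Im z > 0` (differentiation under the integral; the dominating function on
`Im z > Im z₀/2` is `(4/Im z₀)|ψ(t)|e^{−(Im z₀/4)t} ∈ L¹(0,∞)`). RH-FREE.
[cite: Suzuki2025WeilHilbertSpace, CJM §2.3 p. 5 (TeX l.615–619: "H² := H²(ℂ₊) = 𝖥(L²(0,∞)) … the Hardy space in the upper half-plane") and §2.4 p. 5 (TeX l.660: "H^∞(ℂ₊) … analytic functions in ℂ₊")] -/
theorem hasDerivAt_upperHalfHat (f : Lp ℂ 2 (volume : Measure ℝ)) {z₀ : ℂ} (hz₀ : 0 < z₀.im) :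
    HasDerivAt (upperHalfHat f)
      (∫ t in Ioi (0 : ℝ), (f : ℝ → ℂ) t * ((I * t) * cexp (I * z₀ * t))) z₀ := by
  set δ : ℝ := z₀.im / 2 with hδ
  have hδ0 : 0 < δ := by positivity
  set s : Set ℂ := {z | δ < z.im} with hs_def
  have hs : s ∈ 𝓝 z₀ :=
    (isOpen_lt continuous_const Complex.continuous_im).mem_nhds (by simp [hδ]; linarith)
  -- the dominating function `(2/δ)|f(t)|e^{−δt/2}` and its integrability on `(0,∞)`
  have hzd : 0 < (I * ((δ / 2 : ℝ) : ℂ)).im := by simpa using half_pos hδ0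
  have hint_d := integrable_mul_cexp_Ioi f hzd
  have hnorm_exp : ∀ (z : ℂ) (t : ℝ), ‖cexp (I * z * t)‖ = Real.exp (-(z.im * t)) := by
    intro z t
    rw [Complex.norm_exp]
    congr 1
    simp [Complex.mul_re, Complex.mul_im, Complex.I_re, Complex.I_im]
  have hbound_int : Integrable (fun t : ℝ ↦ 2 / δ * ‖(f : ℝ → ℂ) t * cexp (I * (I * ((δ / 2 : ℝ) : ℂ)) * t)‖)
      (volume.restrict (Ioi (0 : ℝ))) :=
    hint_d.norm.const_mul _
  have key := hasDerivAt_integral_of_dominated_loc_of_deriv_le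
    (μ := volume.restrict (Ioi (0 : ℝ)))
    (F := fun (z : ℂ) (t : ℝ) ↦ (f : ℝ → ℂ) t * cexp (I * z * t))
    (F' := fun (z : ℂ) (t : ℝ) ↦ (f : ℝ → ℂ) t * ((I * t) * cexp (I * z * t)))
    (x₀ := z₀) (bound := fun t : ℝ ↦ 2 / δ * ‖(f : ℝ → ℂ) t * cexp (I * (I * ((δ / 2 : ℝ) : ℂ)) * t)‖)
    hs
    (Eventually.of_forall fun z ↦
      ((Lp.aestronglyMeasurable f).restrict.mul (by fun_prop : Continuous fun t : ℝ ↦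
        cexp (I * z * t)).aestronglyMeasurable))
    (integrable_mul_cexp_Ioi f hz₀)
    (((Lp.aestronglyMeasurable f).restrict.mul (by fun_prop : Continuous fun t : ℝ ↦
        (I * t) * cexp (I * z₀ * t)).aestronglyMeasurable))
    ?_ hbound_int ?_
  · exact key.2
  · -- the bound on `s`, for `t > 0`
    filter_upwards [ae_restrict_mem measurableSet_Ioi] with t ht z hz
    have ht0 : 0 < t := ht
    have hz' : δ < z.im := hz
    rw [norm_mul, norm_mul, norm_mul, norm_mul, hnorm_exp, hnorm_exp, Complex.norm_I, one_mul,
      Complex.norm_real, Real.norm_eq_abs, abs_of_pos ht0]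
    have him : (I * ((δ / 2 : ℝ) : ℂ)).im = δ / 2 := by simp
    rw [him]
    -- `|f| t e^{−Im z t} ≤ |f| t e^{−δt} ≤ (2/δ)|f| e^{−δt/2}`
    have h1 : Real.exp (-(z.im * t)) ≤ Real.exp (-(δ * t)) :=
      Real.exp_le_exp.2 (by nlinarith)
    have h2 : t * Real.exp (-(δ * t)) ≤ 2 / δ * Real.exp (-(δ / 2 * t)) := by
      have h3 := mul_exp_neg_le_one (δ / 2 * t)
      have e : Real.exp (-(δ * t)) = Real.exp (-(δ / 2 * t)) * Real.exp (-(δ / 2 * t)) := by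
        rw [← Real.exp_add]; ring_nf
      rw [e, ← mul_assoc]
      have h4 : t * Real.exp (-(δ / 2 * t)) ≤ 2 / δ := by
        rw [le_div_iff₀ hδ0]
        nlinarith [h3, Real.exp_pos (-(δ / 2 * t))]
      exact mul_le_mul_of_nonneg_right h4 (Real.exp_pos _).le
    calc ‖(f : ℝ → ℂ) t‖ * (t * Real.exp (-(z.im * t)))
        ≤ ‖(f : ℝ → ℂ) t‖ * (t * Real.exp (-(δ * t))) := by gcongr
      _ ≤ ‖(f : ℝ → ℂ) t‖ * (2 / δ * Real.exp (-(δ / 2 * t))) := by gcongr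
      _ = 2 / δ * (‖(f : ℝ → ℂ) t‖ * Real.exp (-(δ / 2 * t))) := by ring
  · -- pointwise derivative in `z`
    filter_upwards with t z _
    have h := ((hasDerivAt_id z).const_mul I).mul_const (t : ℂ)
    have h2 := (Complex.hasDerivAt_exp (I * z * t)).comp z h
    have h3 := h2.const_mul ((f : ℝ → ℂ) t)
    refine h3.congr_deriv ?_
    simp only [mul_one]
    ring

/-- **`ψ̂` is holomorphic on the upper half-plane** `ℂ₊ = {Im z > 0}` for every `ψ ∈ L²(ℝ)`
(`H²(ℂ₊) = 𝖥(L²(0,∞))` consists of analytic functions on `ℂ₊`). RH-FREE.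
[cite: Suzuki2025WeilHilbertSpace, CJM §2.3 p. 5 (TeX l.615–619)] -/
theorem differentiableOn_upperHalfHat (f : Lp ℂ 2 (volume : Measure ℝ)) :
    DifferentiableOn ℂ (upperHalfHat f) {z : ℂ | 0 < z.im} := fun _ hz ↦
  (hasDerivAt_upperHalfHat f hz).differentiableAt.differentiableWithinAt

/-- `ψ̂` is analytic on `ℂ₊` (holomorphic on an open set). RH-FREE.
[cite: Suzuki2025WeilHilbertSpace, CJM §2.3 p. 5 (TeX l.615–619)] -/
theorem analyticOnNhd_upperHalfHat (f : Lp ℂ 2 (volume : Measure ℝ)) :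
    AnalyticOnNhd ℂ (upperHalfHat f) {z : ℂ | 0 < z.im} :=
  (differentiableOn_upperHalfHat f).analyticOnNhd (isOpen_lt continuous_const Complex.continuous_im)

/-- Hence the elements `Φ = E_ξ·ψ̂` of the chain spaces `E_ξ𝖥(V(t))` (`suzukiChainSpace`, which asks
for an ENTIRE `Φ` agreeing with `E_ξ(z)ψ̂(z)` on `ℂ₊`) are at least pinned down on `ℂ₊`: the
right-hand side `z ↦ E_ξ(z)ψ̂(z)` is holomorphic there for every `ψ ∈ L²(ℝ)`. RH-FREE.
[cite: Suzuki2025WeilHilbertSpace, CJM Lemma 5.1 p. 13 ("𝓗(E) = E𝖥(V(0)) = {E(z)ψ̂(z) | ψ ∈ V(0)}") and Thm. 5.7 p. 16] -/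
theorem differentiableOn_lagariasE_mul_upperHalfHat (f : Lp ℂ 2 (volume : Measure ℝ)) :
    DifferentiableOn ℂ (fun z : ℂ ↦ lagariasE z * upperHalfHat f z) {z : ℂ | 0 < z.im} :=
  differentiable_lagariasE.differentiableOn.mul (differentiableOn_upperHalfHat f)

end Literature.NumberTheory.LFunctions

end
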